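import Literature.Analysis.FluidPDE.CheskidovDaiPiece
import Literature.Analysis.FluidPDE.CheskidovDaiCovered
import Literature.Analysis.FluidPDE.CheskidovDaiWeightedSum
import Literature.Analysis.FluidPDE.CheskidovDaiOccupationCriterion
import Literature.Analysis.FluidPDE.CheskidovShvydkoyRegularProofs
import Literature.Analysis.FluidPDE.LerayLocalRegularH1Proofs
import Literature.Analysis.FluidPDE.TaoQuantitativeLPPointwise
import HarnessLib

/-!
# The Cheskidov–Dai bootstrap along `(T/2, T)` and the discharge of the occupation criterion

Analysis/FluidPDE file: **proof** of the named fact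
`Literature.Analysis.FluidPDE.cheskidov_dai_occupation_regular` (Cheskidov–Dai, arXiv:1507.06611 =
Proc. Edinburgh Math. Soc. (2025), §1 Thm. 1.1, Navier–Stokes case, as-printed `H¹` form): there is an
absolute `c > 0` such that every Leray–Hopf solution of the unforced system on `ℝ³ × [0,T)` which is
`H¹`-regular on `(0,T)` and whose level occupation integrals satisfy
`limsup_q ∫_{(T/2,T)} 1_{2^q ≤ Λ_{c,ν}(u(τ))} 2^q ‖Δ̇_q u(τ)‖_∞ dτ ≤ c` is `H¹`-regular on `(0, T]`.
* `exists_eH1NormSq_le_of_occupation` (section `Bootstrap`; Cheskidov–Shvydkoy 2010, proof of Lemma 3.2,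
  with the Grönwall step of Cheskidov–Dai §3.1): if `u` is Leray–Hopf on `[0,T)`, `H¹`-regular on
  `(T/2, T)`, the occupation integrals of the levels above `q*` are at most `2c` and the data are small
  (`B_κ (cν) C_r² d ≤ ν`, `16 B_f c ≤ 1`), then `‖u(t)‖²_{H¹}` is bounded on a left neighbourhood of `T`:
  restart at good times from Leray's regular local solutions (`CheskidovDaiPiece.piece_lowMode`), chain the
  two-point inequalities (`two_point_chain`), bound the dyadic energy on every covered interval by the
  constant of `dyadicF_toReal_le_of_covered` (a uniform lifespan); finitely many steps cover `[s₁, β']`.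
* `cheskidov_dai_occupation_regular_holds` (section `Final`) — Leray's continuation in the `H¹` class
  (`leray_continuation_H1_holds`) reduces the claim to the boundedness of `‖u(t)‖²_{H¹}` at the right end
  of every interval of regularity; away from `T` this is the hypothesis, at `T` it is the bootstrap, fed
  by `leray_local_regular_H1_holds`, `CheskidovDaiWeightedSum.sum_Icc_weighted_nonlinear_le_lowMode` (with
  the Bernstein constants of `exists_eLpNorm_top_fderiv_blockFn_le` / `exists_lipschitz_blockFn_le`) and
  the split of the occupation hypothesis at a level `q*` beyond which every occupation integral is at most
  `2c`. The constant is `c = (16 B_f + 9 B_κ C_r² + 1)⁻¹` (`B_f, B_κ` the low-mode constants).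

## References
* A. Cheskidov, M. Dai, arXiv:1507.06611 = Proc. Edinburgh Math. Soc. (2025), §1 Thm. 1.1, §3.1.
  [CheskidovDai2015]
* A. Cheskidov, R. Shvydkoy, arXiv:0708.3067, Lemma 3.2 (proof). [CheskidovShvydkoy2010]
-/

noncomputable section

open MeasureTheory Filter Topology Function Set
open Literature.Analysis.FunctionSpaces
open scoped ENNReal NNReal RealInnerProductSpace

namespace Literature.Analysis.FluidPDE

section Bootstrap
open LPBounds

variable {ν T : ℝ} {u₀ : EuclideanSpace ℝ (Fin 3) → EuclideanSpace ℝ (Fin 3)}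
  {u : ℝ → EuclideanSpace ℝ (Fin 3) → EuclideanSpace ℝ (Fin 3)}

/-- **The bootstrap** (Cheskidov–Dai §3.1 with Cheskidov–Shvydkoy's restarting argument). Let `u` be
Leray–Hopf on `[0,T)`, `ν > 0`, with Leray's regular local solutions (`LerayLocalRegularH1With c₀`), the
low-mode bound on the weighted nonlinear terms for smooth divergence-free slices (`hNL`, constants
`B_f, B_κ < ∞`), a threshold `c > 0` with `B_κ (cν) C_r² d ≤ ν` and `16 B_f c ≤ 1`, `‖u(t)‖₂ ≤ E₀`,
occupation integrals `∫⁻_{(T/2,T)} 1_{2^q ≤ Λ(u τ)} 2^q ‖Δ̇_q u(τ)‖_∞ dτ ≤ 2c` for `q > q*`, and low sums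
below `q*` bounded by `M* < ∞`. If `u` is `H¹`-regular on `(T/2, T)`, then `‖u(t)‖²_{H¹}` is bounded on a
left neighbourhood of `T`. [cite: CheskidovDai2015, §3.1 (closing paragraph)] -/
theorem exists_eH1NormSq_le_of_occupation (K : LPBounds (Fin 3)) (hν : 0 < ν) (hT : 0 < T)
    (hLH : IsLerayHopfOn T ν 0 u₀ u) {c₀ : ℝ} (hc₀ : 0 < c₀) (hreg : LerayLocalRegularH1With c₀)
    {c : ℝ} (hc : 0 < c) {Bf Bκ : ℝ≥0∞} (hBf : Bf ≠ ∞) (hBκ : Bκ ≠ ∞)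
    (hNL : ∀ w : EuclideanSpace ℝ (Fin 3) → EuclideanSpace ℝ (Fin 3), IsSmoothL2Field w → VectorCalculus.IsDivFree w →
      ∀ (J : ℤ) (κ : ℝ≥0∞) (L : ℕ), (∀ l, J < l → blockSup w l ≤ κ * (2 : ℝ≥0∞) ^ l) →
        ∑ j ∈ Finset.Icc (-(L : ℤ)) L, (2 : ℝ≥0∞) ^ (2 * j) * ‖∫ x, ⟪blockFn j w x, blockFn j (convect w w) x⟫‖ₑ ≤
          Bf * ((∑' n : ℕ, (2 : ℝ≥0∞) ^ (J - n) * blockSup w (J - n)) * dyadicF w) +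
            Bκ * (κ * dyadicSqSum (fun l => (2 : ℝ≥0∞) ^ l * blockL2 w l)))
    (hsmall : Bκ * ENNReal.ofReal (c * ν) * (K.Cr : ℝ≥0∞) ^ 2 * Fintype.card (Fin 3) ≤ ENNReal.ofReal ν)
    (hθ : 16 * Bf.toReal * c ≤ 1)
    {E₀ : ℝ≥0} (hE₀ : ∀ τ ∈ Icc 0 T, eLpNorm (u τ) 2 volume ≤ E₀)
    {qs : ℕ} (hocc : ∀ q : ℕ, qs < q →
      ∫⁻ τ in Ioo (T / 2) T, {τ' : ℝ | (2 : ℝ≥0∞) ^ q ≤ dissipationWavenumber c ν (u τ')}.indicator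
        (fun τ' => (2 : ℝ≥0∞) ^ q * eLpNorm (blockFn (q : ℤ) (u τ')) ∞ volume) τ ≤ ENNReal.ofReal (2 * c))
    {Mstar : ℝ≥0∞} (hMstar_top : Mstar ≠ ∞)
    (hMstar : ∀ τ ∈ Icc 0 T, ∑' n : ℕ, (2 : ℝ≥0∞) ^ ((qs : ℤ) - n) * blockSup (u τ) ((qs : ℤ) - n) ≤ Mstar)
    (hregI : IsH1RegularOn (Ioo (T / 2) T) u) :
    ∃ s₁ ∈ Ioo (T / 2) T, ∃ M : ℝ≥0∞, M < ∞ ∧ ∀ t ∈ Ico s₁ T, eH1NormSq (u t) ≤ M := by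
  set f : ℝ → ℝ := fun τ => (dyadicF (u τ)).toReal with hf
  set FJ : ℝ → ℝ≥0∞ := fun τ => ∑' n : ℕ, (2 : ℝ≥0∞) ^ (((sSup {j : ℕ | IsSaturatedLevel c ν (u τ) j} : ℕ) : ℤ) - n) *
    blockSup (u τ) (((sSup {j : ℕ | IsSaturatedLevel c ν (u τ) j} : ℕ) : ℤ) - n) with hFJ
  set g : ℕ → ℝ → ℝ≥0∞ := fun q τ => {τ' : ℝ | (2 : ℝ≥0∞) ^ q ≤ dissipationWavenumber c ν (u τ')}.indicator
    (fun τ' => (2 : ℝ≥0∞) ^ q * eLpNorm (blockFn (q : ℤ) (u τ')) ∞ volume) τ with hg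
  set ω : ℝ → ℝ → ℝ := fun s t => 2 * (Bf * ∫⁻ τ in Ioc s t, FJ τ).toReal with hω
  have hf0 : ∀ τ, 0 ≤ f τ := fun τ => ENNReal.toReal_nonneg
  -- the piece lemma, specialised
  have hpiece := fun (σ : ℝ) (hσ : σ ∈ Ioo 0 T) (hLHσ : IsLerayHopfOn (T - σ) ν 0 (u σ) (fun t => u (t + σ)))
      (A d : ℝ) (hA : 0 ≤ A) (hAσ : eWeakGradL2Sq (u σ) ≤ ENNReal.ofReal A) (hd : 0 < d) (hσd : σ + d ≤ T)
      (hAd : A ^ 2 * d ≤ c₀ * ν ^ 3) =>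
    piece_lowMode K hν hLH hreg hc hBf hBκ hNL hsmall hE₀ hσ hLHσ hA hAσ hd hσd hAd
  -- Step 0: a good time `s₀ ∈ (T/2, T)` and the first piece
  have hT2 : 0 ≤ T / 2 := by linarith
  obtain ⟨s₀, hs₀, hLHs₀⟩ := hLH.exists_isLerayHopfOn_restart_Ioo hν.le hT2 (by linarith : T / 2 < T) le_rfl
  have hs₀T : s₀ ∈ Ioo 0 T := ⟨hT2.trans_lt hs₀.1, hs₀.2⟩
  have hfin₀ : eH1NormSq (u s₀) < ∞ := hregI.1 s₀ hs₀
  set A₀ : ℝ := (eH1NormSq (u s₀)).toReal with hA₀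
  have hA₀0 : 0 ≤ A₀ := ENNReal.toReal_nonneg
  have hAs₀ : eWeakGradL2Sq (u s₀) ≤ ENNReal.ofReal A₀ := by
    rw [hA₀, ENNReal.ofReal_toReal hfin₀.ne, eH1NormSq_def]
    exact le_add_self
  set δ₀ : ℝ := min (c₀ * ν ^ 3 / (A₀ ^ 2 + 1)) (T - s₀) with hδ₀
  have hδ₀pos : 0 < δ₀ := lt_min (div_pos (by positivity) (by positivity)) (sub_pos.2 hs₀.2)
  have hδ₀β : s₀ + δ₀ ≤ T := by linarith [min_le_right (c₀ * ν ^ 3 / (A₀ ^ 2 + 1)) (T - s₀)]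
  have hAδ₀ : A₀ ^ 2 * δ₀ ≤ c₀ * ν ^ 3 := by
    calc A₀ ^ 2 * δ₀ ≤ A₀ ^ 2 * (c₀ * ν ^ 3 / (A₀ ^ 2 + 1)) := by gcongr; exact min_le_left _ _
      _ = c₀ * ν ^ 3 * (A₀ ^ 2 / (A₀ ^ 2 + 1)) := by ring
      _ ≤ c₀ * ν ^ 3 * 1 := by
          gcongr; rw [div_le_one (by positivity)]; linarith
      _ = c₀ * ν ^ 3 := mul_one _
  obtain ⟨hrep₀, h2p₀⟩ := hpiece s₀ hs₀T hLHs₀ A₀ δ₀ hA₀0 hAs₀ hδ₀pos hδ₀β hAδ₀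
  set s₁ : ℝ := s₀ + δ₀ / 2 with hs₁
  have hs₁I : s₁ ∈ Ioo (T / 2) T := ⟨by linarith [hs₀.1], by linarith⟩
  -- Step 1: the uniform constants
  set Fmax : ℝ := 2 * (2 * f s₁ * (4 : ℝ) ^ (2 * Bf.toReal * (Mstar.toReal * T))) +
      (2 * f s₁ * (4 : ℝ) ^ (2 * Bf.toReal * (Mstar.toReal * T))) ^ 2 * ((20 * K.Cinf) ^ 2 / (c * ν) ^ 2) with hFmax
  have hFmax0 : 0 ≤ Fmax := by have := hf0 s₁; positivity
  set Bmax : ℝ := 2 * ((K.Cb : ℝ) ^ 2 * (Fintype.card (Fin 3) * Fmax)) with hBmax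
  have hBmax0 : 0 ≤ Bmax := by rw [hBmax]; positivity
  set δ : ℝ := c₀ * ν ^ 3 / (Bmax ^ 2 + 1) with hδ
  have hδpos : 0 < δ := div_pos (by positivity) (by positivity)
  have hBδ : Bmax ^ 2 * δ ≤ c₀ * ν ^ 3 := by
    calc Bmax ^ 2 * δ = c₀ * ν ^ 3 * (Bmax ^ 2 / (Bmax ^ 2 + 1)) := by rw [hδ]; ring
      _ ≤ c₀ * ν ^ 3 * 1 := by gcongr; rw [div_le_one (by positivity)]; linarith
      _ = c₀ * ν ^ 3 := mul_one _
  -- the enstrophy at a covered time is controlled by `f`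
  have hgrad : ∀ σ, (∃ w : EuclideanSpace ℝ (Fin 3) → EuclideanSpace ℝ (Fin 3), IsSmoothL2Field w ∧ u σ =ᵐ[volume] w) →
      f σ ≤ Fmax → eWeakGradL2Sq (u σ) ≤ ENNReal.ofReal Bmax := by
    rintro σ ⟨w, hw, hae⟩ hfσ
    have htop : dyadicF (u σ) ≠ ∞ := dyadicF_ne_top_of_rep K hw hae
    refine (eWeakGradL2Sq_le_of_rep K hw hae).trans ?_
    rw [hBmax, ENNReal.ofReal_mul (by norm_num), ENNReal.ofReal_mul (by positivity), ENNReal.ofReal_mul (by positivity),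
      ENNReal.ofReal_pow (by positivity), ENNReal.ofReal_coe_nnreal, ENNReal.ofReal_ofNat, ENNReal.ofReal_natCast]
    gcongr
    rw [← ENNReal.ofReal_toReal htop]
    exact ENNReal.ofReal_le_ofReal hfσ
  -- the quantitative bootstrap on a covered interval
  have hgron : ∀ b, b < T → s₁ ≤ b →
      (∀ s ∈ Icc s₁ b, ∀ t ∈ Icc s b, f t ≤ f s + ω s t * sSup (f '' Icc s t)) →
      (∃ B, ∀ τ ∈ Icc s₁ b, f τ ≤ B) →
      (∀ τ ∈ Icc s₁ b, ∃ w : EuclideanSpace ℝ (Fin 3) → EuclideanSpace ℝ (Fin 3), IsSmoothL2Field w ∧ u τ =ᵐ[volume] w) →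
      (∀ q : ℕ, AEMeasurable (g q) (volume.restrict (Icc s₁ b))) →
      (∃ M : ℝ≥0∞, M ≠ ∞ ∧ ∀ τ ∈ Icc s₁ b, FJ τ ≤ M) →
      ∀ t ∈ Icc s₁ b, f t ≤ Fmax := by
    intro b hbT hs₁b h2p hB hrep hmeas hM t ht
    exact dyadicF_toReal_le_of_covered K hν hT hc hBf hθ hocc hMstar_top hMstar hs₁I.1.le hs₁b hbT h2p hB hrep hmeas hM ht
  clear_value Fmax Bmax δ
  -- Step 2: the induction, for a fixed `β' < T`
  have hcover : ∀ β', s₁ < β' → β' < T →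
      (∀ s ∈ Icc s₁ β', ∀ t ∈ Icc s β', f t ≤ f s + ω s t * sSup (f '' Icc s t)) ∧
      (∃ B, ∀ τ ∈ Icc s₁ β', f τ ≤ B) ∧
      (∀ τ ∈ Icc s₁ β', ∃ w : EuclideanSpace ℝ (Fin 3) → EuclideanSpace ℝ (Fin 3), IsSmoothL2Field w ∧ u τ =ᵐ[volume] w) ∧
      (∀ q : ℕ, AEMeasurable (g q) (volume.restrict (Icc s₁ β'))) ∧
      (∃ M : ℝ≥0∞, M ≠ ∞ ∧ ∀ τ ∈ Icc s₁ β', FJ τ ≤ M) := by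
    intro β' hβ'1 hβ'2
    -- `P k`: coverage up to `min (s₁ + k δ/8) β'`
    have hP : ∀ k : ℕ, ∃ b, min (s₁ + k * (δ / 8)) β' ≤ b ∧ b ≤ β' ∧ s₁ < b ∧
        (∀ s ∈ Icc s₁ b, ∀ t ∈ Icc s b, f t ≤ f s + ω s t * sSup (f '' Icc s t)) ∧
        (∃ B, ∀ τ ∈ Icc s₁ b, f τ ≤ B) ∧
        (∀ τ ∈ Icc s₁ b, ∃ w : EuclideanSpace ℝ (Fin 3) → EuclideanSpace ℝ (Fin 3), IsSmoothL2Field w ∧ u τ =ᵐ[volume] w) ∧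
        (∀ q : ℕ, AEMeasurable (g q) (volume.restrict (Icc s₁ b))) ∧
        (∃ M : ℝ≥0∞, M ≠ ∞ ∧ ∀ τ ∈ Icc s₁ b, FJ τ ≤ M) := by
      intro k
      induction k with
      | zero =>
        -- the first piece `[s₁, min (s₀ + δ₀) β']`
        set b := min (s₀ + δ₀) β' with hb
        have hs₁b : s₁ < b := lt_min (by linarith) hβ'1
        obtain ⟨h2p, hB, hmeas, hM⟩ := h2p₀ (δ₀ / 2) (b - s₀) (by linarith) (by linarith)
          (by linarith [min_le_left (s₀ + δ₀) β']) (by linarith [min_le_right (s₀ + δ₀) β'])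
        have e1 : s₀ + δ₀ / 2 = s₁ := by rw [hs₁]
        have e2 : s₀ + (b - s₀) = b := by ring
        rw [e1, e2] at h2p hB hmeas hM
        refine ⟨b, by simp [le_of_lt hs₁b], min_le_right _ _, hs₁b, h2p, hB, fun τ hτ => hrep₀ τ ⟨by linarith [hτ.1], ?_⟩,
          hmeas, hM⟩
        linarith [hτ.2, min_le_left (s₀ + δ₀) β']
      | succ k ih =>
        obtain ⟨b, hbmin, hbβ', hs₁b, h2p, ⟨B, hB⟩, hrep, hmeas, ⟨M, hMtop, hM⟩⟩ := ih
        rcases eq_or_lt_of_le hbβ' with hbeq | hblt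
        · refine ⟨b, ?_, hbβ', hs₁b, h2p, ⟨B, hB⟩, hrep, hmeas, ⟨M, hMtop, hM⟩⟩
          rw [hbeq]; exact min_le_right _ _
        -- a good time `σ ∈ (max s₁ (b - δ/8), b)`
        have hmax : max s₁ (b - δ / 8) < b := max_lt hs₁b (by linarith)
        obtain ⟨σ, hσ, hLHσ⟩ := hLH.exists_isLerayHopfOn_restart_Ioo hν.le (a := max s₁ (b - δ / 8)) (b := b)
          (le_max_of_le_left (by linarith [hs₁I.1])) hmax (hbβ'.trans hβ'2.le)
        have hσ1 : s₁ < σ := (le_max_left _ _).trans_lt hσ.1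
        have hσ2 : b - δ / 8 < σ := (le_max_right _ _).trans_lt hσ.1
        have hσT : σ ∈ Ioo 0 T := ⟨by linarith [hs₁I.1, hσ1], by linarith [hβ'2, hσ.2, hbβ']⟩
        -- enstrophy bound at `σ`
        have hfσ : f σ ≤ Fmax := hgron b (hblt.trans hβ'2) hs₁b.le h2p ⟨B, hB⟩ hrep hmeas ⟨M, hMtop, hM⟩ σ ⟨hσ1.le, hσ.2.le⟩
        have hAσ : eWeakGradL2Sq (u σ) ≤ ENNReal.ofReal Bmax := hgrad σ (hrep σ ⟨hσ1.le, hσ.2.le⟩) hfσ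
        -- the new piece
        set d := min δ (T - σ) with hd
        have hdpos : 0 < d := lt_min hδpos (by linarith [hσ.2, hbβ', hβ'2])
        have hσd : σ + d ≤ T := by linarith [min_le_right δ (T - σ)]
        have hBd : Bmax ^ 2 * d ≤ c₀ * ν ^ 3 := (mul_le_mul_of_nonneg_left (min_le_left _ _) (sq_nonneg _)).trans hBδ
        obtain ⟨hrepσ, h2pσ⟩ := hpiece σ hσT hLHσ Bmax d hBmax0 hAσ hdpos hσd hBd
        set bp := min (σ + δ) β' with hbp
        have hbbp : b ≤ bp := le_min (by linarith) hbβ'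
        have hcb : (σ + b) / 2 ≤ b := by linarith [hσ.2]
        obtain ⟨h2pnew, ⟨B', hB'⟩, hmeasnew, ⟨M', hM'top, hM'⟩⟩ := h2pσ ((b - σ) / 2) (bp - σ) (by linarith [hσ.2])
          (by
            have : (σ + b) / 2 < bp := lt_min (by linarith [hσ.2]) (by linarith [hσ.2])
            linarith)
          (by
            rw [hd]
            refine le_min ?_ ?_ <;> linarith [min_le_left (σ + δ) β', min_le_right (σ + δ) β'])
          (by linarith [min_le_right (σ + δ) β'])
        have heq1 : σ + (b - σ) / 2 = (σ + b) / 2 := by ring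
        have heq2 : σ + (bp - σ) = bp := by ring
        rw [heq1, heq2] at h2pnew hB' hmeasnew hM'
        -- the invariants on `[s₁, bp]`
        have hBall : ∀ τ ∈ Icc s₁ bp, f τ ≤ max B B' := by
          intro τ hτ
          rcases le_or_gt τ b with hτb | hτb
          · exact (hB τ ⟨hτ.1, hτb⟩).trans (le_max_left _ _)
          · exact (hB' τ ⟨by linarith, hτ.2⟩).trans (le_max_right _ _)
        have hMall : ∀ τ ∈ Icc s₁ bp, FJ τ ≤ max M M' := by
          intro τ hτ
          rcases le_or_gt τ b with hτb | hτb
          · exact (hM τ ⟨hτ.1, hτb⟩).trans (le_max_left _ _)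
          · exact (hM' τ ⟨by linarith, hτ.2⟩).trans (le_max_right _ _)
        have hMall_top : max M M' ≠ ∞ := by
          rcases max_cases M M' with ⟨h, _⟩ | ⟨h, _⟩ <;> rw [h] <;> assumption
        obtain ⟨hω0, hωeq, -, -⟩ := omega_props (a := s₁) (b := bp) (Bf := Bf) hMall_top hBf hMall
        have h2p' : ∀ s ∈ Icc s₁ bp, ∀ t ∈ Icc s bp, f t ≤ f s + ω s t * sSup (f '' Icc s t) :=
          two_point_chain (ω := ω) h2p h2pnew hcb hbbp hω0 (fun s t u hs hst htu hu => (hωeq s t u hs hst htu hu).le)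
            (fun τ _ => hf0 τ) hBall
        have hbpd : bp ≤ σ + d := by
          rw [hd, ← min_add_add_left, add_sub_cancel]
          exact min_le_min le_rfl hβ'2.le
        have hrep' : ∀ τ ∈ Icc s₁ bp, ∃ w : EuclideanSpace ℝ (Fin 3) → EuclideanSpace ℝ (Fin 3),
            IsSmoothL2Field w ∧ u τ =ᵐ[volume] w := by
          intro τ hτ
          rcases le_or_gt τ b with hτb | hτb
          · exact hrep τ ⟨hτ.1, hτb⟩
          · exact hrepσ τ ⟨by linarith [hσ.2], hτ.2.trans hbpd⟩
        have hmeas' : ∀ q : ℕ, AEMeasurable (g q) (volume.restrict (Icc s₁ bp)) := by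
          intro q
          have hun : AEMeasurable (g q) (volume.restrict (Icc s₁ b ∪ Icc ((σ + b) / 2) bp)) :=
            aemeasurable_union_iff.2 ⟨hmeas q, hmeasnew q⟩
          refine hun.mono_set fun τ hτ => ?_
          rcases le_or_gt τ b with hτb | hτb
          · exact Or.inl ⟨hτ.1, hτb⟩
          · exact Or.inr ⟨by linarith [hσ.2], hτ.2⟩
        refine ⟨bp, ?_, min_le_right _ _, hs₁b.trans_le hbbp, h2p', ⟨max B B', hBall⟩, hrep', hmeas',
          ⟨max M M', hMall_top, hMall⟩⟩
        -- progress
        have hkb : s₁ + k * (δ / 8) ≤ b := by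
          rcases min_le_iff.1 hbmin with h | h
          · exact h
          · exact absurd h (not_le.2 hblt)
        refine min_le_min_right β' ?_
        push_cast
        linarith [hkb, hσ2]
    -- take `k` large
    obtain ⟨k, hk⟩ := exists_nat_ge ((β' - s₁) / (δ / 8))
    obtain ⟨b, hbmin, hbβ', -, h2p, hB, hrep, hmeas, hM⟩ := hP k
    have hkδ : β' ≤ s₁ + k * (δ / 8) := by
      have hδ8 : 0 < δ / 8 := by linarith
      have h1 : (β' - s₁) / (δ / 8) * (δ / 8) = β' - s₁ := div_mul_cancel₀ _ hδ8.ne'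
      have h2 : (β' - s₁) / (δ / 8) * (δ / 8) ≤ k * (δ / 8) := mul_le_mul_of_nonneg_right hk hδ8.le
      linarith
    have hb : b = β' := le_antisymm hbβ' (by rw [min_eq_right hkδ] at hbmin; exact hbmin)
    subst hb
    exact ⟨h2p, hB, hrep, hmeas, hM⟩
  -- Step 3: the bound
  refine ⟨s₁, hs₁I, (E₀ : ℝ≥0∞) ^ 2 + ENNReal.ofReal Bmax, ?_, fun t ht => ?_⟩
  · exact ENNReal.add_lt_top.2 ⟨ENNReal.pow_lt_top ENNReal.coe_lt_top, ENNReal.ofReal_lt_top⟩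
  · set β' := (t + T) / 2 with hβ'
    have hβ'1 : s₁ < β' := by rw [hβ']; linarith [ht.1, ht.2]
    have hβ'2 : β' < T := by rw [hβ']; linarith [ht.2]
    have htβ' : t ∈ Icc s₁ β' := ⟨ht.1, by rw [hβ']; linarith [ht.2]⟩
    obtain ⟨h2p, hB, hrep, hmeas, hM⟩ := hcover β' hβ'1 hβ'2
    have hft : f t ≤ Fmax := hgron β' hβ'2 hβ'1.le h2p hB hrep hmeas hM t htβ'
    rw [eH1NormSq_def]
    refine add_le_add ?_ (hgrad t (hrep t htβ') hft)
    rw [eEnergy_eq_eLpNorm_sq]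
    exact ENNReal.pow_le_pow_left (hE₀ t ⟨by linarith [hs₁I.1, ht.1], ht.2.le⟩)

end Bootstrap

section Final
open LPBounds

/-- **Cheskidov–Dai 2015, Thm. 1.1 (NSE, as-printed `H¹` form), proved.** [cite: CheskidovDai2015, §1 Thm. 1.1 (case b ≡ 0, r = ∞)] -/
theorem cheskidov_dai_occupation_regular_holds : cheskidov_dai_occupation_regular := by
  obtain ⟨c₀, hc₀, hreg⟩ := leray_local_regular_H1_holds
  set K := lpBounds (Fin 3) with hK
  -- the Bernstein constants of the low-mode bound
  obtain ⟨Csup, hCsup⟩ := exists_eLpNorm_top_fderiv_blockFn_le (E := EuclideanSpace ℝ (Fin 3)) (ι := Fin 3)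
  obtain ⟨CL, hCL⟩ := exists_lipschitz_blockFn_le (E := EuclideanSpace ℝ (Fin 3)) (ι := Fin 3)
  set d : ℝ≥0∞ := (Fintype.card (Fin (Module.finrank ℝ (EuclideanSpace ℝ (Fin 3)))) : ℝ≥0∞) with hd
  set M₁ : ℝ≥0∞ := ENNReal.ofReal (∫ z : EuclideanSpace ℝ (Fin 3), ‖blockKernel (EuclideanSpace ℝ (Fin 3)) 0 z‖ * ‖z‖) with hM₁
  set C₁ : ℝ≥0∞ := ∫⁻ z, ‖blockKernel (EuclideanSpace ℝ (Fin 3)) 0 z‖ₑ with hC₁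
  have hC₁top : C₁ ≠ ∞ := (integrable_blockKernel (E := EuclideanSpace ℝ (Fin 3)) 0).2.ne
  have hdtop : d ≠ ∞ := ENNReal.natCast_ne_top _
  set A₁₂ : ℝ≥0∞ := d * (4 * d * CL * M₁ * K.Cb + 64 * K.C₂ * K.Cb) + d * K.C₂ * Csup with hA₁₂
  set A₃ : ℝ≥0∞ := d * C₁ * K.Cb with hA₃
  have hA₁₂top : A₁₂ ≠ ∞ := by
    refine ENNReal.add_ne_top.2 ⟨ENNReal.mul_ne_top hdtop (ENNReal.add_ne_top.2 ⟨?_, ?_⟩), ?_⟩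
    · exact ENNReal.mul_ne_top (ENNReal.mul_ne_top (ENNReal.mul_ne_top (ENNReal.mul_ne_top (by norm_num) hdtop)
        ENNReal.coe_ne_top) ENNReal.ofReal_ne_top) ENNReal.coe_ne_top
    · exact ENNReal.mul_ne_top (ENNReal.mul_ne_top (by norm_num) ENNReal.coe_ne_top) ENNReal.coe_ne_top
    · exact ENNReal.mul_ne_top (ENNReal.mul_ne_top hdtop ENNReal.coe_ne_top) ENNReal.coe_ne_top
  have hA₃top : A₃ ≠ ∞ := ENNReal.mul_ne_top (ENNReal.mul_ne_top hdtop hC₁top) ENNReal.coe_ne_top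
  set Bf : ℝ≥0∞ := 20 * A₁₂ + 80 * A₃ with hBf
  set Bκ : ℝ≥0∞ := (2 : ℝ≥0∞) ^ (-5 : ℤ) * 5 * A₁₂ + 2 ^ (13 : ℕ) * 20 * A₃ with hBκ
  have hBftop : Bf ≠ ∞ := ENNReal.add_ne_top.2 ⟨ENNReal.mul_ne_top (by norm_num) hA₁₂top, ENNReal.mul_ne_top (by norm_num) hA₃top⟩
  have hBκtop : Bκ ≠ ∞ := ENNReal.add_ne_top.2 ⟨ENNReal.mul_ne_top (ENNReal.mul_ne_top (two_zpow_ne_top _) (by norm_num)) hA₁₂top,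
    ENNReal.mul_ne_top (by norm_num) hA₃top⟩
  -- the low-mode bound for smooth divergence-free slices
  have hNL : ∀ w : EuclideanSpace ℝ (Fin 3) → EuclideanSpace ℝ (Fin 3), IsSmoothL2Field w → VectorCalculus.IsDivFree w →
      ∀ (J : ℤ) (κ : ℝ≥0∞) (L : ℕ), (∀ l, J < l → blockSup w l ≤ κ * (2 : ℝ≥0∞) ^ l) →
        ∑ j ∈ Finset.Icc (-(L : ℤ)) L, (2 : ℝ≥0∞) ^ (2 * j) * ‖∫ x, ⟪blockFn j w x, blockFn j (convect w w) x⟫‖ₑ ≤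
          Bf * ((∑' n : ℕ, (2 : ℝ≥0∞) ^ (J - n) * blockSup w (J - n)) * dyadicF w) +
            Bκ * (κ * dyadicSqSum (fun l => (2 : ℝ≥0∞) ^ l * blockL2 w l)) :=
    fun w hw hdiv J κ L hs => sum_Icc_weighted_nonlinear_le_lowMode K hCsup hCL hw hdiv hs L
  -- the absolute constant
  set D : ℝ := 16 * Bf.toReal + 3 * (Bκ.toReal * (K.Cr : ℝ) ^ 2 * 3) + 1 with hD
  have hDpos : 0 < D := by positivity
  set c : ℝ := 1 / D with hc
  have hcpos : 0 < c := by positivity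
  have hcD : c * D = 1 := by rw [hc]; field_simp
  have hθ : 16 * Bf.toReal * c ≤ 1 := by
    have h1 : 16 * Bf.toReal ≤ D := by
      have : 0 ≤ 3 * (Bκ.toReal * (K.Cr : ℝ) ^ 2 * 3) := by positivity
      linarith
    nlinarith
  have hκsmall : Bκ.toReal * (c * 1) * (K.Cr : ℝ) ^ 2 * 3 ≤ 1 := by
    have h1 : 3 * (Bκ.toReal * (K.Cr : ℝ) ^ 2 * 3) ≤ D := by
      have : 0 ≤ 16 * Bf.toReal := by positivity
      linarith
    nlinarith [hcpos]
  refine ⟨c, hcpos, fun ν T hν hT u₀ u hLH hregT hlim => ?_⟩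
  -- smallness of the dissipative constant: `B_κ (cν) C_r² · 3 ≤ ν`
  have hsmall : Bκ * ENNReal.ofReal (c * ν) * (K.Cr : ℝ≥0∞) ^ 2 * Fintype.card (Fin 3) ≤ ENNReal.ofReal ν := by
    have hcν : 0 ≤ c * ν := by positivity
    have h1 : Bκ * ENNReal.ofReal (c * ν) * (K.Cr : ℝ≥0∞) ^ 2 * Fintype.card (Fin 3) =
        ENNReal.ofReal (Bκ.toReal * (c * ν) * (K.Cr : ℝ) ^ 2 * 3) := by
      conv_rhs => rw [ENNReal.ofReal_mul (by positivity), ENNReal.ofReal_mul (by positivity),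
        ENNReal.ofReal_mul ENNReal.toReal_nonneg, ENNReal.ofReal_toReal hBκtop, ENNReal.ofReal_pow (NNReal.coe_nonneg K.Cr),
        ENNReal.ofReal_coe_nnreal, ENNReal.ofReal_ofNat]
      rw [Fintype.card_fin]
      push_cast
      rfl
    rw [h1]
    refine ENNReal.ofReal_le_ofReal ?_
    have := mul_le_mul_of_nonneg_right hκsmall hν.le
    nlinarith [hν]
  -- the energy bound and the level `q*`
  obtain ⟨E₀, hE₀⟩ := exists_eLpNorm_slice_le hLH hν.le
  have hlim2 : limsup (fun q : ℕ => ∫⁻ τ in Ioo (T / 2) T,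
      {τ | (2 : ℝ≥0∞) ^ q ≤ dissipationWavenumber c ν (u τ)}.indicator
        (fun τ => (2 : ℝ≥0∞) ^ q * eLpNorm (blockFn (q : ℤ) (u τ)) ∞ volume) τ) atTop < ENNReal.ofReal (2 * c) :=
    lt_of_le_of_lt hlim ((ENNReal.ofReal_lt_ofReal_iff (by positivity)).2 (by linarith))
  obtain ⟨qs, hqs⟩ := Filter.eventually_atTop.1 (Filter.eventually_lt_of_limsup_lt hlim2)
  have hocc : ∀ q : ℕ, qs < q → ∫⁻ τ in Ioo (T / 2) T,
      {τ' : ℝ | (2 : ℝ≥0∞) ^ q ≤ dissipationWavenumber c ν (u τ')}.indicator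
        (fun τ' => (2 : ℝ≥0∞) ^ q * eLpNorm (blockFn (q : ℤ) (u τ')) ∞ volume) τ ≤ ENNReal.ofReal (2 * c) :=
    fun q hq => (hqs q hq.le).le
  -- the low sums below `q*`
  set Mstar : ℝ≥0∞ := (2 : ℝ≥0∞) ^ (qs : ℤ) * (K.Cinf * E₀ *
      (2 : ℝ≥0∞) ^ ((((qs : ℤ) + 1 - 1 : ℤ) : ℝ) * Fintype.card (Fin 3) * 2⁻¹) * LPBounds.geomDim (Fin 3)) with hMstar
  have hexp0 : (0 : ℝ) ≤ (((qs : ℤ) + 1 - 1 : ℤ) : ℝ) * Fintype.card (Fin 3) * 2⁻¹ := by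
    rw [add_sub_cancel_right]; positivity
  have hMstar_top : Mstar ≠ ∞ := ENNReal.mul_ne_top (two_zpow_ne_top _) (ENNReal.mul_ne_top (ENNReal.mul_ne_top
    (ENNReal.mul_ne_top ENNReal.coe_ne_top ENNReal.coe_ne_top) (ENNReal.rpow_ne_top_of_nonneg hexp0 ENNReal.ofNat_ne_top))
    LPBounds.geomDim_lt_top.ne)
  have hMstar_le : ∀ τ ∈ Icc 0 T, ∑' n : ℕ, (2 : ℝ≥0∞) ^ ((qs : ℤ) - n) * blockSup (u τ) ((qs : ℤ) - n) ≤ Mstar := by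
    intro τ hτ
    refine (lowSum_le_of_eLpNorm_le K (hLH.memLp τ hτ) (qs : ℤ)).trans ?_
    rw [hMstar]
    gcongr
    exact hE₀ τ hτ
  -- Leray's continuation in the `H¹` class
  refine leray_continuation_H1_holds ν T hν hT u₀ u hLH fun α β hα hαβ hβT _ => ?_
  rcases lt_or_eq_of_le hβT with hβ | hβ
  · -- away from `T`: `u` is `H¹`-regular at `β`
    have hβI : β ∈ Ioo 0 T := ⟨hα.trans_lt hαβ, hβ⟩
    have hcont : ContinuousWithinAt (fun t => eH1NormSq (u t)) (Ioo 0 β) β :=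
      ((hregT.2 β hβI).mono (Ioo_subset_Ioo le_rfl hβ.le))
    have htend : Tendsto (fun t => eH1NormSq (u t)) (𝓝[<] β) (𝓝 (eH1NormSq (u β))) := by
      rw [← nhdsWithin_Ioo_eq_nhdsLT hβI.1]; exact hcont
    rw [htend.limsup_eq]
    exact hregT.1 β hβI
  · -- at `T`: the bootstrap
    subst hβ
    have hregI : IsH1RegularOn (Ioo (β / 2) β) u := hregT.mono (Ioo_subset_Ioo (by linarith) le_rfl)
    obtain ⟨s₁, hs₁, M, hM, hbound⟩ := exists_eH1NormSq_le_of_occupation K hν hT hLH hc₀ hreg hcpos hBftop hBκtop hNL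
      hsmall hθ hE₀ hocc hMstar_top hMstar_le hregI
    refine lt_of_le_of_lt (Filter.limsup_le_of_le ?_ ?_) hM
    · isBoundedDefault
    · filter_upwards [Ico_mem_nhdsLT hs₁.2] with t ht using hbound t ht

end Final

end Literature.Analysis.FluidPDE

end
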